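import Summits.BirchSwinnertonDyer.BirchSwinnertonDyer.Theorems.SignedLowerHalvesSprungLowerDivisibilityAtThreeTypedInputsInconsistent
import Summits.BirchSwinnertonDyer.Rank1Residual.X1.LambdaSqueezeAlgebra
import Literature.NumberTheory.EllipticCurves.IwasawaAlgebraInvolutionEvenLambdaProofs
import Literature.NumberTheory.EllipticCurves.IwasawaAlgebraRankOneIdealProofs
import HarnessLib

/-!
# Crux `SprungLowerDivisibilityAtThree` (K1, item stmt-BirchSwinnertonDyer-19875), line `chromatic-common-zeros`:
# a colour with `λ = 1` and `L^•(0) ≠ 0` carries an `ι`-UNPAIRED zero — NO `ι`-datum needed (`p` odd)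

Cell `bsd-ssimc` (host), width seat `cruxlead-stmt-BirchSwinnertonDyer-19875-w2` (gen 10) under the 19875 LEAD;
`--supports stmt-BirchSwinnertonDyer-19875 --as helper`; THEOREMS ONLY; route-independent imports (no `Theses` module in the
cone); closes NOTHING, refutes NOTHING (the cell data are displayed hypotheses).

The LEAD's per-pair negatives (`…TypedInputsInconsistent.lean`, `Negative/…FalseOfPrintedKatoUnpairedZeroX8.lean`) consume an
`ι`-UNPAIRED zero of one colour `L^∘`: a height-one `𝔭₀ ∌ p` with `L^∘ ∈ 𝔭₀`, `ι L^∘ ∉ 𝔭₀`. So far the kernel produced it from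
the (R12) datum «`μ = 0`, `λ = 2`, `L^∘(0) ≠ 0`, `L^∘(T^ι) ∉ (L^∘)`» (an `ι`-computation on `3`-adic digits) or from a coprimality
certificate. THIS FILE: the datum «`μ(L^∘) = 0`, `λ(L^∘) = 1`, `L^∘(0) ≠ 0`» ALONE suffices, by PARITY — the unique zero of a
`λ = 1` series is a `ℤ_p`-rational point `u ≠ 0` of the open disc, and its prime `(T − u)` is never `ι`-fixed for `p` odd
(this seat's Literature theorem `IwasawaAlgebra.even_lambdaInvariant_quotient_of_comap_invol_eq`: an `ι`-fixed prime `∌ T` has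
EVEN `λ(Λ/𝔭)`; here `λ(Λ/𝔭₀) = λ(π) = 1`), so `ι L^∘ ∉ (T − u) ∋ L^∘`. Greenberg's remark (LNM 1716 §5: «since `λ^{anal} = 1`,
`f` has exactly one root `a` … `(1+a)⁻¹ − 1` is also a root … `a = 0`») read contrapositively off `T = 0`.

* §1 **`exists_heightOne_unpairedZero_of_lam_one (hp2) (hF0) (hμ : mu F = 0) (hlam : lam F = 1) (hc : F(0) ≠ 0)`**:
  `∃ 𝔭`, height one, `p ∉ 𝔭`, `F ∈ 𝔭`, `ι F ∉ 𝔭` (pure algebra of `Λ = ℤ_p⟦T⟧`; twin of the LEAD's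
  `exists_heightOne_unpairedZero_of_lam_two_of_subst_not_mem` WITHOUT the `hdat` hypothesis); `…_subst` form.
* §2 **`not_sprungSharpFlatLowerDivisibility_of_printedKato_of_lam_one`**: on an X8 pair, a colour `∘` with `μ = 0`, `λ = 1`,
  `L^∘(0) ≠ 0` REFUTES the typed (γ-keyed) leaf at `∘`, modulo Sprung Thm. 7.14, Thm. 7.16 in print keying and the period unit
  (the LEAD's `not_sprungSharpFlatLowerDivisibility_of_printedKato_of_unpairedZero`).
* §3 **`exists_unpairedZeroX8_of_lam_one`**: such a cell yields the BODY of the analytic witness `SprungPairUnpairedZeroX8` of the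
  gate-shaped negative lemma `SprungLowerDivisibilityAtThree_false_of_PrintedKatoUnpairedZeroX8` (p665377; stated there, in the
  `Theses` cone — here only its `∃`-text, so that this file stays route-independent): the certificate shrinks to three numeric
  invariants of one colour (`μ = 0`, `λ = 1`, constant term `≠ 0`).

BSD, K1, K_spor are NOT proved; nothing is refuted (no cell is constructed in the kernel); `mu`/`lam` are the tree's
`X1.MuLambda` invariants of a power series.
-/

set_option autoImplicit false
-- the single-conjunct summit namespace `Summit.BirchSwinnertonDyer.BirchSwinnertonDyer` repeats by design (D-0017)
set_option linter.dupNamespace false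

noncomputable section

open scoped Classical NumberField MatrixGroups ModularForm

open NumberField IsDedekindDomain CongruenceSubgroup WeierstrassCurve PowerSeries
  Literature.NumberTheory.EllipticCurves Literature.NumberTheory.EllipticCurves.ModularForms
  Literature.NumberTheory.EllipticCurves.ZpExtension Literature.NumberTheory.EllipticCurves.Sprung2017
  Literature.NumberTheory.EllipticCurves.Sprung2012 Literature.NumberTheory.EllipticCurves.Rank1Residual
  Literature.NumberTheory.EllipticCurves.IwasawaAlgebra Literature.Barriers.BirchSwinnertonDyer
  Summit.BirchSwinnertonDyer.Rank1Residual.X1.MuLambda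

namespace Summit.BirchSwinnertonDyer.BirchSwinnertonDyer.Theorems

namespace ChromaticKeying

/-! ## §1 Pure algebra: `μ = 0`, `λ = 1`, `F(0) ≠ 0` ⟹ an `ι`-unpaired height-one zero off `(p)` -/

section Algebra

variable {p : ℕ} [hp : Fact p.Prime]

/-- `Λ/(π)` is a torsion `Λ`-module for `π ≠ 0` (every class is killed by `π`). -/
theorem isTorsion_quotient_span_singleton {π : IwasawaAlgebra p} (hπ0 : π ≠ 0) :
    Module.IsTorsion (IwasawaAlgebra p) (IwasawaAlgebra p ⧸ Ideal.span {π}) := by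
  intro x
  obtain ⟨y, rfl⟩ := Ideal.Quotient.mk_surjective x
  refine ⟨⟨π, mem_nonZeroDivisors_of_ne_zero hπ0⟩, ?_⟩
  change Ideal.Quotient.mk (Ideal.span {π}) (π * y) = 0
  exact Ideal.Quotient.eq_zero_iff_mem.mpr (Ideal.mem_span_singleton.mpr ⟨y, rfl⟩)

/-- **A `λ = 1` series off `T` has an `ι`-UNPAIRED height-one zero off `(p)` (`p ≠ 2`).** In `Λ = ℤ_p⟦T⟧`: if `F ≠ 0`,
`μ(F) = 0`, `λ(F) = 1` and `F(0) ≠ 0`, then some height-one prime `𝔭` has `p ∉ 𝔭`, `F ∈ 𝔭`, `ι F ∉ 𝔭` (`ι : T ↦ (1+T)⁻¹ − 1`).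
Proof: `F` is a non-unit, so an irreducible `π ∣ F`, `F = π·G`; additivity of `μ, λ` forces `μ(π) = 0`, `λ(π) = 1`, `G ∈ Λˣ`;
`𝔭 := (π)` has height one, `p ∉ 𝔭` (else `π ~ p`, `μ(F) ≥ 1`), `T ∉ 𝔭` (else `π ~ T`, `F(0) = 0`). If `ι F ∈ 𝔭` then `ι π ∈ 𝔭`
(`ι G` is a unit), whence `(ι π) = (π)` (`π = ι(ι π)`), i.e. `ι𝔭 = 𝔭`; but an `ι`-fixed prime `∌ T` has EVEN `λ(Λ/𝔭)`
(`IwasawaAlgebra.even_lambdaInvariant_quotient_of_comap_invol_eq`), while `λ(Λ/(π)) = λ(π) = 1` (`char(Λ/(π)) = (π)`,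
`ParitySqueeze.lam_generator_eq_lambdaInvariant`). No `ι`-datum is assumed. [cite: GreenbergLNM1716, §5 (a `λ = 1` root and its
mirror `(1+a)⁻¹ − 1`)] [cite: Washington1997, §7.1 (Thm. 7.3) and §13.2] -/
theorem exists_heightOne_unpairedZero_of_lam_one (hp2 : p ≠ 2) {F : IwasawaAlgebra p} (hF0 : F ≠ 0)
    (hμF : mu F = 0) (hlamF : lam F = 1) (hcF : PowerSeries.constantCoeff F ≠ 0) :
    ∃ 𝔭 : PrimeSpectrum (IwasawaAlgebra p), 𝔭.asIdeal.height = 1 ∧ (p : IwasawaAlgebra p) ∉ 𝔭.asIdeal ∧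
      F ∈ 𝔭.asIdeal ∧ invol p F ∉ 𝔭.asIdeal := by
  -- `F` is not a unit (`λ(F) = 1 ≠ 0`)
  have hFnu : ¬ IsUnit F := by
    intro hu
    have h := ((isUnit_iff_mu_eq_zero_and_lam_eq_zero F).1 hu).2.2
    rw [hlamF] at h
    exact one_ne_zero h
  -- an irreducible (hence prime) factor `π ∣ F`, `F = π * G`
  obtain ⟨π, hπirr, hπF⟩ := WfDvdMonoid.exists_irreducible_factor hFnu hF0
  have hπ : Prime π := hπirr.prime
  have hπ0 : π ≠ 0 := hπ.ne_zero
  haveI hprime : (Ideal.span {π}).IsPrime := (Ideal.span_singleton_prime hπ0).mpr hπ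
  let 𝔭 : PrimeSpectrum (IwasawaAlgebra p) := ⟨Ideal.span {π}, hprime⟩
  have h1 : 𝔭.asIdeal.height = 1 := Module.height_span_singleton_eq_one_of_prime hπ
  have hF𝔭 : F ∈ 𝔭.asIdeal := Ideal.mem_span_singleton.mpr hπF
  obtain ⟨G, hFG⟩ := hπF
  have hG0 : G ≠ 0 := fun h ↦ hF0 (by rw [hFG, h, mul_zero])
  -- `μ/λ` bookkeeping: `λ(π) = 1`, `G` a unit
  have hlam : lam π + lam G = 1 := by rw [← lam_mul hπ0 hG0, ← hFG, hlamF]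
  have hmu : mu π + mu G = 0 := by rw [← mu_mul hπ0 hG0, ← hFG, hμF]
  have hlamπ : lam π = 1 := by
    rcases Nat.eq_zero_or_pos (lam π) with h0 | _
    · exact absurd ((isUnit_iff_mu_eq_zero_and_lam_eq_zero π).2 ⟨hπ0, by omega, h0⟩) hπirr.not_isUnit
    · omega
  have hGu : IsUnit G := (isUnit_iff_mu_eq_zero_and_lam_eq_zero G).2 ⟨hG0, by omega, by omega⟩
  -- `p ∉ 𝔭`: otherwise `π ∣ p`, `π ~ p`, `p ∣ F`, `μ(F) ≥ 1`
  have hp𝔭 : (p : IwasawaAlgebra p) ∉ 𝔭.asIdeal := by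
    intro hp𝔭
    have hπp : π ∣ (p : IwasawaAlgebra p) := Ideal.mem_span_singleton.mp hp𝔭
    have hpprime : Prime (p : IwasawaAlgebra p) := IwasawaAlgebra.prime_natCast
    have hassoc : Associated π (p : IwasawaAlgebra p) := hπirr.associated_of_dvd hpprime.irreducible hπp
    have hpF : (p : IwasawaAlgebra p) ∣ F := hassoc.symm.dvd.trans ⟨G, hFG⟩
    have hC : PowerSeries.C ((p : ℤ_[p]) ^ 1) ∣ F := by
      rwa [pow_one, map_natCast]
    have h1le : 1 ≤ mu F := le_mu_of_C_pow_dvd hF0 hC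
    rw [hμF] at h1le
    exact Nat.not_succ_le_zero 0 h1le
  -- `T ∉ 𝔭`: otherwise `π ∣ T`, `π ~ T`, `T ∣ F`, `F(0) = 0`
  have hX𝔭 : (PowerSeries.X : IwasawaAlgebra p) ∉ 𝔭.asIdeal := by
    intro hX
    have hπX : π ∣ (PowerSeries.X : IwasawaAlgebra p) := Ideal.mem_span_singleton.mp hX
    have hassoc : Associated π (PowerSeries.X : IwasawaAlgebra p) :=
      hπirr.associated_of_dvd PowerSeries.X_prime.irreducible hπX
    have hXF : (PowerSeries.X : IwasawaAlgebra p) ∣ F := hassoc.symm.dvd.trans ⟨G, hFG⟩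
    exact hcF (PowerSeries.X_dvd_iff.mp hXF)
  refine ⟨𝔭, h1, hp𝔭, hF𝔭, ?_⟩
  -- suppose `ι F ∈ 𝔭`; then `ι π ∈ 𝔭` (`ι G` is a unit)
  intro hιF
  have hιπ : invol p π ∈ 𝔭.asIdeal := by
    rw [hFG, map_mul] at hιF
    rcases hprime.mem_or_mem hιF with h | h
    · exact h
    · exact absurd (𝔭.asIdeal.eq_top_of_isUnit_mem h (hGu.map (invol p))) hprime.ne_top
  -- hence `(ι π) = (π)` and `ι𝔭 = 𝔭`
  have hspan : Ideal.span {invol p π} = Ideal.span {π} := by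
    apply le_antisymm
    · exact (Ideal.span_singleton_le_iff_mem _).mpr hιπ
    · rw [Ideal.span_singleton_le_iff_mem, Ideal.mem_span_singleton]
      obtain ⟨h, hh⟩ := Ideal.mem_span_singleton.mp hιπ
      exact ⟨invol p h, by rw [← map_mul, ← hh, invol_invol]⟩
  have hfix : PrimeSpectrum.comap (invol p).toRingHom 𝔭 = 𝔭 := by
    apply PrimeSpectrum.ext
    rw [PrimeSpectrum.comap_asIdeal]
    ext f
    rw [Ideal.mem_comap]
    change invol p f ∈ Ideal.span {π} ↔ f ∈ Ideal.span {π}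
    constructor
    · intro hf
      rw [← hspan] at hf
      obtain ⟨h, hh⟩ := Ideal.mem_span_singleton.mp hf
      exact Ideal.mem_span_singleton.mpr ⟨invol p h, by rw [← invol_invol p f, hh, map_mul, invol_invol]⟩
    · intro hf
      obtain ⟨h, hh⟩ := Ideal.mem_span_singleton.mp hf
      rw [← hspan]
      exact Ideal.mem_span_singleton.mpr ⟨invol p h, by rw [hh, map_mul]⟩
  -- parity: an `ι`-fixed prime `∌ T` has even `λ(Λ/𝔭)`, but `λ(Λ/(π)) = λ(π) = 1`
  have heven := IwasawaAlgebra.even_lambdaInvariant_quotient_of_comap_invol_eq hp2 𝔭 hfix hX𝔭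
  have hbridge : lam π = lambdaInvariant p (IwasawaAlgebra p ⧸ Ideal.span {π}) :=
    Summit.BirchSwinnertonDyer.Rank1Residual.X1.ParitySqueeze.lam_generator_eq_lambdaInvariant
      (IwasawaAlgebra p ⧸ Ideal.span {π}) (isTorsion_quotient_span_singleton hπ0) hπ0
      (Literature.NumberTheory.EllipticCurves.Module.charIdeal_quotient_span_singleton hπ0)
  have h1even : Even (1 : ℕ) := by
    rw [← hlamπ, hbridge]
    exact heven
  exact Nat.not_even_one h1even

/-- The same with the substitution spelling `F(T^ι) = PowerSeries.subst invOnePlusSubOne F` of the X8 files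
(`ChromaticKeying.invol_eq_subst`). [cite: GreenbergLNM1716, §5] -/
theorem exists_heightOne_unpairedZero_of_lam_one_subst (hp2 : p ≠ 2) {F : IwasawaAlgebra p} (hF0 : F ≠ 0)
    (hμF : mu F = 0) (hlamF : lam F = 1) (hcF : PowerSeries.constantCoeff F ≠ 0) :
    ∃ 𝔭 : PrimeSpectrum (IwasawaAlgebra p), 𝔭.asIdeal.height = 1 ∧ (p : IwasawaAlgebra p) ∉ 𝔭.asIdeal ∧
      F ∈ 𝔭.asIdeal ∧ PowerSeries.subst (invOnePlusSubOne : IwasawaAlgebra p) F ∉ 𝔭.asIdeal := by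
  obtain ⟨𝔭, h1, hp𝔭, hF, hι⟩ := exists_heightOne_unpairedZero_of_lam_one hp2 hF0 hμF hlamF hcF
  exact ⟨𝔭, h1, hp𝔭, hF, by rwa [invol_eq_subst] at hι⟩

/-- **A `λ = 1` series off `T` is never `ι`-self-dual**: `F(T^ι) ∉ (F)` — the (R12)-type datum is AUTOMATIC at `λ = 1`.
[cite: GreenbergLNM1716, §5] -/
theorem invol_not_mem_span_of_lam_one (hp2 : p ≠ 2) {F : IwasawaAlgebra p} (hF0 : F ≠ 0)
    (hμF : mu F = 0) (hlamF : lam F = 1) (hcF : PowerSeries.constantCoeff F ≠ 0) :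
    invol p F ∉ Ideal.span {F} := by
  obtain ⟨𝔭, -, -, hF, hι⟩ := exists_heightOne_unpairedZero_of_lam_one hp2 hF0 hμF hlamF hcF
  exact fun h ↦ hι ((Ideal.span_singleton_le_iff_mem _).mpr hF h)

end Algebra

/-! ## §2 Per pair: a `λ = 1` colour refutes the typed leaf at that colour (modulo the printed facts) -/

section Leaf

variable (W : WeierstrassCurve ℚ) [W.IsElliptic] [W.IsGloballyMinimal] (p : ℕ) [Fact p.Prime]

/-- **PER-PAIR: a colour `∘` with `μ(L^∘) = 0`, `λ(L^∘) = 1`, `L^∘(0) ≠ 0` REFUTES the typed (γ-keyed) leaf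
`SprungSharpFlatLowerDivisibility W p ∘`** on an X8 pair, modulo Sprung Thm. 7.14, Thm. 7.16 in print keying and the period unit
at `3` (by name): §1 supplies the `ι`-unpaired zero, the LEAD's `not_sprungSharpFlatLowerDivisibility_of_printedKato_of_unpairedZero`
the negative. Compare the (R12) form (`…_of_lam_two_of_subst_not_mem`), which needs the extra `ι`-datum.
[cite: Sprung2012, Thm. 7.14 and Thm. 7.16 (p. 1504), Main Conj. 7.21 (p. 1505)] [cite: GreenbergLNM1716, §1 (p. 60), §5] -/
theorem not_sprungSharpFlatLowerDivisibility_of_printedKato_of_lam_one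
    (h714 : thm714_sharpFlatSelmerDual_finite_torsion) (h716c : thm716_sharpFlatCharIdeal_divisibility_contra)
    (hper : realPeriodRat_eq_unit_mul_plusPeriod_three) (hX : ClassX8 W p)
    {N : ℕ} [NeZero N] (f : CuspForm (Gamma0 N) 2) (Lsharp Lflat : IwasawaAlgebra p) (hf : IsNewformOf W f)
    (hSP : IsSprungPair f p (W.frobeniusTrace p) Lsharp Lflat) (col : Chroma)
    (hμ : mu (chromaticL col Lsharp Lflat) = 0) (hlam : lam (chromaticL col Lsharp Lflat) = 1)
    (hc0 : PowerSeries.constantCoeff (chromaticL col Lsharp Lflat) ≠ 0) :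
    ¬ SprungSharpFlatLowerDivisibility W p col := by
  have hp2 : p ≠ 2 := by rw [hX.p_eq]; decide
  have hF0 : chromaticL col Lsharp Lflat ≠ 0 := fun h ↦ hc0 (by rw [h, map_zero])
  obtain ⟨𝔭₀, -, hp𝔭₀, hL, hιL⟩ := exists_heightOne_unpairedZero_of_lam_one hp2 hF0 hμ hlam hc0
  exact not_sprungSharpFlatLowerDivisibility_of_printedKato_of_unpairedZero W p h714 h716c hper hX f Lsharp Lflat hf hSP col
    𝔭₀ hp𝔭₀ hL hιL

end Leaf

/-! ## §3 A `λ = 1` cell is the analytic witness of the gate-shaped negative lemma -/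

section Witness

/-- **The analytic witness from a `λ = 1` cell**: ONE X8 pair with a newform, a Sprung pair and a colour `∘` with `μ(L^∘) = 0`,
`λ(L^∘) = 1`, `L^∘(0) ≠ 0` supplies the `∃`-BODY of `SprungPairUnpairedZeroX8` (the analytic conjunct of the hypothesis of
`SprungLowerDivisibilityAtThree_false_of_PrintedKatoUnpairedZeroX8`, p665377): an X8 pair, newform, Sprung pair, colour and a prime
`𝔭₀ ∌ p` with `L^∘ ∈ 𝔭₀`, `ι L^∘ ∉ 𝔭₀` — three numeric invariants of one colour, no `ι`-computation. (Conclusion spelled out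
rather than named, to keep this file out of the `Theses` cone; `SprungPairUnpairedZeroX8` is this text verbatim.)
[cite: GreenbergLNM1716, §5] [cite: Sprung2012, Def. 6.1 (p. 1495)] -/
theorem exists_unpairedZeroX8_of_lam_one
    (hcell : ∃ (W : WeierstrassCurve ℚ) (_ : W.IsElliptic) (_ : W.IsGloballyMinimal) (p : ℕ) (_ : Fact p.Prime)
      (_ : ClassX8 W p) (N : ℕ) (_ : NeZero N) (f : CuspForm (Gamma0 N) 2) (Lsharp Lflat : IwasawaAlgebra p)
      (_ : IsNewformOf W f) (_ : IsSprungPair f p (W.frobeniusTrace p) Lsharp Lflat) (col : Chroma),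
      mu (chromaticL col Lsharp Lflat) = 0 ∧ lam (chromaticL col Lsharp Lflat) = 1 ∧
        PowerSeries.constantCoeff (chromaticL col Lsharp Lflat) ≠ 0) :
    ∃ (W : WeierstrassCurve ℚ) (_ : W.IsElliptic) (_ : W.IsGloballyMinimal) (p : ℕ) (_ : Fact p.Prime)
      (_ : ClassX8 W p) (N : ℕ) (_ : NeZero N) (f : CuspForm (Gamma0 N) 2) (Lsharp Lflat : IwasawaAlgebra p)
      (_ : IsNewformOf W f) (_ : IsSprungPair f p (W.frobeniusTrace p) Lsharp Lflat) (col : Chroma)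
      (𝔭₀ : PrimeSpectrum (IwasawaAlgebra p)),
      (p : IwasawaAlgebra p) ∉ 𝔭₀.asIdeal ∧ chromaticL col Lsharp Lflat ∈ 𝔭₀.asIdeal ∧
        invol p (chromaticL col Lsharp Lflat) ∉ 𝔭₀.asIdeal := by
  obtain ⟨W, hE, hGM, p, hpr, hX, N, hN, f, Lsharp, Lflat, hf, hSP, col, hμ, hlam, hc0⟩ := hcell
  have hp2 : p ≠ 2 := by rw [hX.p_eq]; decide
  have hF0 : chromaticL col Lsharp Lflat ≠ 0 := fun h ↦ hc0 (by rw [h, map_zero])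
  obtain ⟨𝔭₀, -, hp𝔭₀, hL, hιL⟩ := exists_heightOne_unpairedZero_of_lam_one hp2 hF0 hμ hlam hc0
  exact ⟨W, hE, hGM, p, hpr, hX, N, hN, f, Lsharp, Lflat, hf, hSP, col, 𝔭₀, hp𝔭₀, hL, hιL⟩

end Witness

end ChromaticKeying

end Summit.BirchSwinnertonDyer.BirchSwinnertonDyer.Theorems

end
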